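import Literature.NumberTheory.LFunctions.Zhang2022.RepairFormulaIGram

/-!
# K1″a DISPLAY #5 in the kernel: the degree-0 polar table `K0polar` IS formula I symmetrised, and its defect against `𝔅` polarised off the one-sided class

Y. Zhang, *Discrete mean estimates and the Landau–Siegel zero*, arXiv:2211.02515v1
[Zhang2022LandauSiegel] — an unrefereed manuscript under adjudication; **nothing here asserts any of
its claims, and nothing here is a statement about Landau–Siegel zeros** (cell `landau-siegel`, rung
F-S3 §D, toeplitz route `ZDegreeToeplitzBand`, crux K0 = `InClassSideTables` stmt-Parity-20016; the
programme SEARCHES and TYPES).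

The K1″a hand's DISPLAY #5 (HOME/ls-knife-typer-1/K1A-DISPLAY-5-K0polar.md 56ff66626537e9f8) derives,
from Prop 7.1 + Lemma 8.1 + Lemma 8.2 (→ LEMMA A, the `ψ`-side jet `𝔧_j(u;z) = u′(z) + iπb_j u(z)`) +
Lemmas 8.3/8.4 (→ LEMMA A*, the anti-side MASS RULE `𝔪_j(w;z) = −π²b_{j′}b_{j″}∫_z^1 w + iπ(b_{j′}+b_{j″})w(z)
− w′(z)`) + (8.10)–(8.12), the closed form of the degree-0 polar table
`K0polar(u,v) = −(1/π) Σ_j c_j [∫₀¹ 𝔧_j(u;z)𝔪_j(v̄;z) dz + conj ∫₀¹ 𝔧_j(v;z)𝔪_j(ū;z) dz]`,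
`b = (1,2,3)`, `(j′,j″)` cyclic, `c = (½, 2, 3/2)`, and certifies EXACTLY that it equals the tree's
`mainTermFormPolar` on in-class pairs (`u(1) = v(1) = 0`).

**Dictionary (pure algebra, proved here).** `KnifeEdge.k0jet j` = LEMMA A's jet = the first factor of
`Repair.dipoleIntegrand j`; `KnifeEdge.k0mass s N` = LEMMA A*'s mass rule, and
`𝔪_j(v̄;·) = k0mass (bS j) (bN j) v̄ = −conj(v′ + iπ·bS j·v + π²·bN j·∫_·^1 v)` is minus the conjugate of
the second factor (`Repair.bS j = 6 − j = b_{j′}+b_{j″}`, `Repair.bN j = j² − 6j + 11 = b_{j′}b_{j″}`: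
`(2+3, 2·3), (3+1, 3·1), (1+2, 1·2)`); `c_j` = Prop 7.1's weights of `Repair.Mform`. Hence
(`k0jet_mul_k0mass_eq`, `k0X_eq_neg_pi_mul_Mform`, `k0polarDisplay_eq_k0polar`, no hypothesis on the
profiles) `X(u,v) := Σ_j c_j ∫𝔧_j(u)𝔪_j(v̄) = −π·Mform(u,v)` and the display's literal closed form
`KnifeEdge.k0polarDisplay` equals `KnifeEdge.k0polar u u′ v v′ := Mform u u′ v v′ + conj (Mform v v′ u u′)`,
formula I symmetrised. Consequently DISPLAY #5 §3's identity («(S)» of the cell's M-RULEBOOK (D15)) is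
the tree theorem `Repair.mainTermFormPolar_eq_Mform` (`RepairFormulaIGram`, F-S1R rung K-S1):
`KnifeEdge.k0polar_eq_mainTermFormPolar` below is one line.

**What this file adds** (one integration by parts with the boundary term KEPT):
* `Repair.integral_deriv_mul_conj_primitive_eq` — `∫₀¹ g′·conj S_h = g(1)·conj(∫₀¹h) − ∫₀¹ g h̄` for a
  kinked `g` and continuous `h` (the tree's `integral_deriv_mul_conj_primitive` is the case `g(1) = 0`);
  `Repair.integral_deriv_eq_sub_kinked` — `∫₀¹ g′ = g(1) − g(0)`.
* `Repair.integral_dipoleIntegrand_eq'`, `Repair.Mform_eq_atoms'` — the tree's atom expansions of one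
  `j`-summand and of `Mform` hold VERBATIM WITHOUT the hypothesis `g 1 = 0` (the `g(1)` boundary
  contributions of `∫ g′·conj(∫_y^1 h)` cancel): that hypothesis is idle there.
* `Repair.mainTermFormPolar_sub_Mform`, `KnifeEdge.mainTermFormPolar_sub_k0polar` — for ALL pairs of
  kinked profiles (no endpoint condition)
  `P(u,v) − K0polar(u,v) = Δ(u,v) := −12π[conj(m_v)·u(1) + m_u·conj(v(1))] − 8i[u(0)·conj(v(1)) − u(1)·conj(v(0))]`
  (`KnifeEdge.k0polarDefect`; `m_w = ∫₀¹ w`): the boundary form that the one-sided condition kills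
  (`k0polarDefect_eq_zero`), i.e. exactly what separates the formula-I value from the (4.1) value on
  profiles that do not vanish at the top (`Δ(1,1) = −24π`). The atoms `∫u·conj v′`, `∫u·conj S_v`,
  `∫S_u·conj v` cancel identically between the two sides — no further integration by parts is used.
* `KnifeEdge.k0polar_self_eq_mainTermForm` — on the diagonal and in class, `K0polar(u,u) = 𝔅(u)`
  (`mainTermForm`), the closed form of `KnifeEdge.InClassMean`; `KnifeEdge.k0polar_swap` (Hermitian).

Sanity values of record (DISPLAY #5 v1.0a §3(1), exact certificate `k0polar_exact.py` 071290f8f9bde23b,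
critic re-derivation by hand; NOT re-proved here): for the disjoint-support two-bump pair both forms equal
`(−289/250 − 51i/250)π + (−153/2500 + 561i/1250)π²`, and for disjoint supports both reduce to
`24π²i·m_u·conj(m_v) − 12π·u(0)·conj(m_v)`.

Hypothesis class: `Repair.KinkedProfile` (continuous on `[0,1]`, a right derivative at every interior
point, derivative in `L²`) — it contains every continuous piecewise-polynomial in-class piece of the
toeplitz route. The `H¹`-only version (`IsH1OnUnitInterval`, no pointwise right derivative) would need
Fubini on the triangle for complex integrands and is NOT attempted here. All declarations are elementary
calculus / bookkeeping, tagged `[cite: Zhang2022LandauSiegel, …]` (they transcribe / dissect the manuscript's formula-I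
structure, as in `RepairFormulaIGram`); private plumbing is `[folklore]`.

The programme SEARCHES and TYPES; no claim about Landau–Siegel zeros, Theorems 1–2 of arXiv:2211.02515
or a repaired Margin232 until a kernel theorem says so.
-/

noncomputable section

open Complex Real ComplexConjugate Set MeasureTheory intervalIntegral

namespace Literature.NumberTheory.LFunctions.Zhang2022

namespace Repair

variable {g g' h h' : ℝ → ℂ}

/-- `conj` commutes with the interval integral. [folklore] -/
private theorem conj_intervalIntegral_k0 (f : ℝ → ℂ) (a b : ℝ) :
    conj (∫ x in a..b, f x) = ∫ x in a..b, conj (f x) := by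
  simp only [intervalIntegral, map_sub, integral_conj]

/-- `conj ∫₀¹ u v̄ = ∫₀¹ v ū`. [folklore] -/
private theorem conj_integral_mul_conj_k0 (u v : ℝ → ℂ) :
    conj (∫ x in (0:ℝ)..1, u x * conj (v x)) = ∫ x in (0:ℝ)..1, v x * conj (u x) := by
  rw [conj_intervalIntegral_k0]
  refine intervalIntegral.integral_congr fun x _ => ?_
  simp only [map_mul, Complex.conj_conj]
  ring

/-- Linearity of `∫₀¹` over four weighted integrable terms. [folklore] -/
private theorem integral_lin4_k0 {f1 f2 f3 f4 : ℝ → ℂ} (c1 c2 c3 c4 : ℂ)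
    (h1 : IntervalIntegrable f1 volume 0 1) (h2 : IntervalIntegrable f2 volume 0 1)
    (h3 : IntervalIntegrable f3 volume 0 1) (h4 : IntervalIntegrable f4 volume 0 1) :
    ∫ x in (0:ℝ)..1, (c1 * f1 x + c2 * f2 x + c3 * f3 x + c4 * f4 x)
      = c1 * (∫ x in (0:ℝ)..1, f1 x) + c2 * (∫ x in (0:ℝ)..1, f2 x)
        + c3 * (∫ x in (0:ℝ)..1, f3 x) + c4 * (∫ x in (0:ℝ)..1, f4 x) := by
  rw [intervalIntegral.integral_add (((h1.const_mul c1).add (h2.const_mul c2)).add (h3.const_mul c3))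
      (h4.const_mul c4),
    intervalIntegral.integral_add ((h1.const_mul c1).add (h2.const_mul c2)) (h3.const_mul c3),
    intervalIntegral.integral_add (h1.const_mul c1) (h2.const_mul c2),
    intervalIntegral.integral_const_mul, intervalIntegral.integral_const_mul,
    intervalIntegral.integral_const_mul, intervalIntegral.integral_const_mul]

/-- The primitive `S_h(x) = ∫₀ˣ h` has derivative `h(x)` at interior points (`h` continuous on `[0,1]`).
[folklore] -/
private theorem hasDerivAt_primitive_unit_k0 (hh : ContinuousOn h (Icc 0 1)) {x : ℝ}
    (hx : x ∈ Ioo (0:ℝ) 1) :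
    HasDerivAt (fun y => ∫ t in (0:ℝ)..y, h t) (h x) x := by
  have hint : IntervalIntegrable h volume 0 x :=
    (hh.mono (Icc_subset_Icc_right hx.2.le)).intervalIntegrable_of_Icc hx.1.le
  have hmeas : StronglyMeasurableAtFilter h (nhds x) volume :=
    ContinuousOn.stronglyMeasurableAtFilter isOpen_Ioo (hh.mono Ioo_subset_Icc_self) x hx
  have hcont : ContinuousAt h x := hh.continuousAt (Icc_mem_nhds hx.1 hx.2)
  exact intervalIntegral.integral_hasDerivAt_right hint hmeas hcont

/-- `∫₀¹ g′ = g(1) − g(0)` for a kinked profile. [cite: Zhang2022LandauSiegel, Prop 7.1 with (8.11)–(8.23), pp.44–50] -/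
theorem integral_deriv_eq_sub_kinked (hg : KinkedProfile g g') :
    (∫ x in (0:ℝ)..1, g' x) = g 1 - g 0 := by
  have := hg.isH1.eq_add_integral 1 ⟨zero_le_one, le_rfl⟩
  linear_combination -this

/-- **Integration by parts against the primitive, boundary term kept**: for a kinked profile `g`
and a continuous `h`, `∫₀¹ g′·conj(S_h) = g(1)·conj(∫₀¹ h) − ∫₀¹ g·conj h`, `S_h(x) = ∫₀ˣ h`
(the tree's `integral_deriv_mul_conj_primitive` is the one-sided case `g(1) = 0`). [cite: Zhang2022LandauSiegel, Prop 7.1 with (8.11)–(8.23), pp.44–50] -/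
theorem integral_deriv_mul_conj_primitive_eq (hg : KinkedProfile g g')
    (hh : ContinuousOn h (Icc 0 1)) :
    (∫ x in (0:ℝ)..1, g' x * conj (∫ t in (0:ℝ)..x, h t))
      = g 1 * conj (∫ t in (0:ℝ)..1, h t) - ∫ x in (0:ℝ)..1, g x * conj (h x) := by
  have hS : ContinuousOn (fun x => ∫ t in (0:ℝ)..x, h t) (Icc 0 1) := continuousOn_primitive_unit hh
  have hΦc : ContinuousOn (fun x => g x * conj (∫ t in (0:ℝ)..x, h t)) (Icc 0 1) :=
    hg.cont.mul (continuousOn_conj_comp hS)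
  have hΦd : ∀ x ∈ Ioo (0:ℝ) 1, HasDerivWithinAt (fun x => g x * conj (∫ t in (0:ℝ)..x, h t))
      (g' x * conj (∫ t in (0:ℝ)..x, h t) + g x * conj (h x)) (Ioi x) x := by
    intro x hx
    exact (hg.hasDeriv x hx).mul
      (hasDerivAt_conj_comp (hasDerivAt_primitive_unit_k0 hh hx)).hasDerivWithinAt
  have hi1 : IntervalIntegrable (fun x => g' x * conj (∫ t in (0:ℝ)..x, h t)) volume 0 1 :=
    hg.isH1.intervalIntegrable.mul_continuousOn
      (by rw [uIcc_of_le zero_le_one]; exact continuousOn_conj_comp hS)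
  have hi2 : IntervalIntegrable (fun x => g x * conj (h x)) volume 0 1 :=
    (hg.cont.mul (continuousOn_conj_comp hh)).intervalIntegrable_of_Icc zero_le_one
  have key := intervalIntegral.integral_eq_sub_of_hasDeriv_right_of_le zero_le_one hΦc hΦd (hi1.add hi2)
  rw [intervalIntegral.integral_add hi1 hi2] at key
  simp only [intervalIntegral.integral_same, map_zero, mul_zero, sub_zero] at key
  linear_combination key

/-- **One `j`-summand of formula I in atom form, NO endpoint condition**: the tree's
`integral_dipoleIntegrand_eq` holds verbatim without its hypothesis `g 1 = 0` — with
`A₁ = ∫g′h̄′`, `A₂ = ∫g′h̄`, `A₄ = ∫gh̄′`, `A₅ = ∫gh̄`, `A₇ = ∫g·conj S_h`, `I_g = ∫g`, `I_h = ∫h`,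
`∫₀¹ (g′+iπjg)conj(h′+iπsh+π²N∫_y^1h) = A₁ − iπsA₂ + π²N(A₅ − g(0)Ī_h) + iπjA₄ + π²jsA₅ + iπ³jN(I_gĪ_h − A₇)`
(the `g(1)·Ī_h` contributions of `∫g′ = g(1) − g(0)` and of `∫g′·conj S_h` cancel).
[cite: Zhang2022LandauSiegel, Prop 7.1 with (8.11)–(8.23), pp.44–50] -/
theorem integral_dipoleIntegrand_eq' (hg : KinkedProfile g g') (hh : KinkedProfile h h') (j : ℕ) :
    ∫ y in (0:ℝ)..1, dipoleIntegrand j g g' h h' y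
      = (∫ x in (0:ℝ)..1, g' x * conj (h' x))
        - I * π * ((bS j : ℝ) : ℂ) * (∫ x in (0:ℝ)..1, g' x * conj (h x))
        + (π : ℂ) ^ 2 * ((bN j : ℝ) : ℂ)
            * ((∫ x in (0:ℝ)..1, g x * conj (h x)) - g 0 * conj (∫ x in (0:ℝ)..1, h x))
        + I * π * (j : ℂ) * (∫ x in (0:ℝ)..1, g x * conj (h' x))
        + (π : ℂ) ^ 2 * (j : ℂ) * ((bS j : ℝ) : ℂ) * (∫ x in (0:ℝ)..1, g x * conj (h x))
        + I * (π : ℂ) ^ 3 * (j : ℂ) * ((bN j : ℝ) : ℂ)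
            * ((∫ x in (0:ℝ)..1, g x) * conj (∫ x in (0:ℝ)..1, h x)
                - ∫ x in (0:ℝ)..1, g x * conj (∫ t in (0:ℝ)..x, h t)) := by
  have hgH := hg.isH1
  have hhH := hh.isH1
  -- integrability of the eight atoms
  have i1 : IntervalIntegrable (fun x => g' x * conj (h' x)) volume 0 1 :=
    IsH1OnUnitInterval.intervalIntegrable_deriv_mul_conj_deriv hgH hhH
  have i2 : IntervalIntegrable (fun x => g' x * conj (h x)) volume 0 1 :=
    IsH1OnUnitInterval.intervalIntegrable_deriv_mul_conj hgH hhH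
  have i3 : IntervalIntegrable g' volume 0 1 := hgH.intervalIntegrable
  have hS : ContinuousOn (fun x => ∫ t in (0:ℝ)..x, h t) (Icc 0 1) :=
    continuousOn_primitive_unit hh.cont
  have i4 : IntervalIntegrable (fun x => g' x * conj (∫ t in (0:ℝ)..x, h t)) volume 0 1 :=
    i3.mul_continuousOn (by rw [uIcc_of_le zero_le_one]; exact continuousOn_conj_comp hS)
  have hch' : IntervalIntegrable (fun x => conj (h' x)) volume 0 1 := by
    rw [intervalIntegrable_iff, uIoc_of_le zero_le_one]
    exact hhH.memLp_conj.integrable one_le_two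
  have i5 : IntervalIntegrable (fun x => g x * conj (h' x)) volume 0 1 :=
    hch'.continuousOn_mul (by rw [uIcc_of_le zero_le_one]; exact hg.cont)
  have i6 : IntervalIntegrable (fun x => g x * conj (h x)) volume 0 1 :=
    IsH1OnUnitInterval.intervalIntegrable_mul_conj hgH hhH
  have i7 : IntervalIntegrable g volume 0 1 := hg.cont.intervalIntegrable_of_Icc zero_le_one
  have i8 : IntervalIntegrable (fun x => g x * conj (∫ t in (0:ℝ)..x, h t)) volume 0 1 :=
    IsH1OnUnitInterval.intervalIntegrable_mul_conj_primitive hgH hhH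
  have ih : IntervalIntegrable h volume 0 1 := hh.cont.intervalIntegrable_of_Icc zero_le_one
  -- abbreviation
  set Ih : ℂ := ∫ x in (0:ℝ)..1, h x with hIh
  -- pointwise expansion on [0,1]
  have hpt : EqOn (dipoleIntegrand j g g' h h')
      (fun x => (1 * (g' x * conj (h' x)) + (-(I * π * ((bS j : ℝ) : ℂ))) * (g' x * conj (h x))
          + ((π : ℂ) ^ 2 * ((bN j : ℝ) : ℂ) * conj Ih) * g' x
          + (-((π : ℂ) ^ 2 * ((bN j : ℝ) : ℂ))) * (g' x * conj (∫ t in (0:ℝ)..x, h t)))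
        + ((I * π * (j : ℂ)) * (g x * conj (h' x))
          + ((π : ℂ) ^ 2 * (j : ℂ) * ((bS j : ℝ) : ℂ)) * (g x * conj (h x))
          + (I * (π : ℂ) ^ 3 * (j : ℂ) * ((bN j : ℝ) : ℂ) * conj Ih) * g x
          + (-(I * (π : ℂ) ^ 3 * (j : ℂ) * ((bN j : ℝ) : ℂ))) * (g x * conj (∫ t in (0:ℝ)..x, h t))))
      (uIcc 0 1) := by
    intro x hx
    rw [uIcc_of_le zero_le_one] at hx
    have htail : (∫ t in x..1, h t) = Ih - ∫ t in (0:ℝ)..x, h t := by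
      rw [hIh, intervalIntegral.integral_interval_sub_left ih (intervalIntegrable_mono_unit ih hx)]
    unfold dipoleIntegrand
    rw [htail]
    simp only [map_add, map_sub, map_mul, map_pow, Complex.conj_I, Complex.conj_ofReal]
    linear_combination (-(π : ℂ) ^ 2 * (j : ℂ) * g x * ((bS j : ℝ) : ℂ) * conj (h x)) * Complex.I_sq
  rw [intervalIntegral.integral_congr hpt,
    intervalIntegral.integral_add
      ((((i1.const_mul _).add (i2.const_mul _)).add (i3.const_mul _)).add (i4.const_mul _))
      ((((i5.const_mul _).add (i6.const_mul _)).add (i7.const_mul _)).add (i8.const_mul _)),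
    integral_lin4_k0 _ _ _ _ i1 i2 i3 i4, integral_lin4_k0 _ _ _ _ i5 i6 i7 i8,
    integral_deriv_eq_sub_kinked hg, integral_deriv_mul_conj_primitive_eq hg hh.cont]
  ring

/-- **Formula I in atom form, NO endpoint condition** — the tree's `Mform_eq_atoms` verbatim without
`g 1 = 0` (`ΣW_j = 4`, `ΣW_js_j = 15`, `ΣW_jN_j = 12`, `ΣW_jb_j = 9`, `ΣW_jb_js_j = 32`, `ΣW_jb_jN_j = 24`):
`M(g,h) = (1/π)[4A₁ − 15iπA₂ + 9iπA₄ + 44π²A₅ − 12π²g(0)Ī_h + 24iπ³(I_gĪ_h − A₇)]`.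
[cite: Zhang2022LandauSiegel, Prop 7.1 with (8.11)–(8.23), pp.44–50] -/
theorem Mform_eq_atoms' (hg : KinkedProfile g g') (hh : KinkedProfile h h') :
    Mform g g' h h' = (((1 / π : ℝ)) : ℂ) *
      (4 * (∫ x in (0:ℝ)..1, g' x * conj (h' x))
        - 15 * I * π * (∫ x in (0:ℝ)..1, g' x * conj (h x))
        + 9 * I * π * (∫ x in (0:ℝ)..1, g x * conj (h' x))
        + 44 * (π : ℂ) ^ 2 * (∫ x in (0:ℝ)..1, g x * conj (h x))
        - 12 * (π : ℂ) ^ 2 * (g 0 * conj (∫ x in (0:ℝ)..1, h x))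
        + 24 * I * (π : ℂ) ^ 3 * ((∫ x in (0:ℝ)..1, g x) * conj (∫ x in (0:ℝ)..1, h x)
            - ∫ x in (0:ℝ)..1, g x * conj (∫ t in (0:ℝ)..x, h t))) := by
  unfold Mform
  rw [integral_dipoleIntegrand_eq' hg hh, integral_dipoleIntegrand_eq' hg hh,
    integral_dipoleIntegrand_eq' hg hh, bS_one, bS_two, bS_three, bN_one, bN_two, bN_three]
  push_cast
  ring

/-- **The defect of the Gram identity off the one-sided class** (`P − (M + conj M∘swap)`), for ALL pairs
of kinked profiles: `P(g,h) − [M(g,h) + conj M(h,g)] = −12π[conj(∫h)·g(1) + (∫g)·conj h(1)] − 8i[g(0)conj h(1) − g(1)conj h(0)]`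
— the tree's `mainTermFormPolar_eq_Mform` is the case `g(1) = h(1) = 0`. [cite: Zhang2022LandauSiegel, Prop 7.1 with (8.11)–(8.23), pp.44–50] -/
theorem mainTermFormPolar_sub_Mform (hg : KinkedProfile g g') (hh : KinkedProfile h h') :
    mainTermFormPolar g g' h h' - (Mform g g' h h' + conj (Mform h h' g g'))
      = -(((12 * π : ℝ)) : ℂ) * (conj (∫ x in (0:ℝ)..1, h x) * g 1 + (∫ x in (0:ℝ)..1, g x) * conj (h 1))
        - 8 * I * (g 0 * conj (h 1) - g 1 * conj (h 0)) := by
  rw [Mform_eq_atoms' hg hh, Mform_eq_atoms' hh hg]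
  unfold mainTermFormPolar mainTermFormSesq
  have hπ : (π : ℂ) ≠ 0 := by exact_mod_cast Real.pi_ne_zero
  have c1 := conj_integral_mul_conj_k0 h' g'
  have c2 := conj_integral_mul_conj_k0 h' g
  have c4 := conj_integral_mul_conj_k0 h g'
  have c5 := conj_integral_mul_conj_k0 h g
  simp only [map_add, map_sub, map_mul, map_pow, Complex.conj_conj, Complex.conj_I,
    Complex.conj_ofReal, map_ofNat, c1, c2, c4, c5]
  push_cast
  field_simp
  ring

end Repair

namespace KnifeEdge

variable {u u' v v' : ℝ → ℂ}

/-- `conj` commutes with the interval integral. [folklore] -/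
private theorem conj_intervalIntegral_ke (f : ℝ → ℂ) (a b : ℝ) :
    conj (∫ x in a..b, f x) = ∫ x in a..b, conj (f x) := by
  simp only [intervalIntegral, map_sub, integral_conj]

/-- **LEMMA A's `ψ`-side jet** `𝔧_j(u;z) = u′(z) + iπ b_j u(z)` (`b_j = j`), DISPLAY #5 §2 / DISPLAY #2
(the main term of Lemma 8.2 for the `m`-factor with profile `u`). [cite: Zhang2022LandauSiegel, §8 Lemma 8.2, pp.44–50] -/
def k0jet (j : ℕ) (u u' : ℝ → ℂ) (z : ℝ) : ℂ :=
  u' z + I * π * (j : ℂ) * u z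

/-- **LEMMA A*'s anti-side MASS RULE** `𝔪(s,N; w)(z) = −π²N ∫_z^1 w + iπ s·w(z) − w′(z)` with
`s = b_{j′}+b_{j″}`, `N = b_{j′}b_{j″}` (DISPLAY #5 §1: the main term of Lemmas 8.3/8.4 for the `n`-factor,
whose MASS term `−π²N∫_z^1 w` comes from the pole of `1/L(1+s,χ)`). [cite: Zhang2022LandauSiegel, §8 Lemmas 8.3–8.4, pp.44–50] -/
def k0mass (s N : ℝ) (w w' : ℝ → ℂ) (z : ℝ) : ℂ :=
  -((π : ℂ) ^ 2 * ((N : ℝ) : ℂ)) * (∫ t in z..1, w t) + I * π * ((s : ℝ) : ℂ) * w z - w' z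

/-- **DISPLAY #5's `X(u,v) := Σ_j c_j ∫₀¹ 𝔧_j(u;z)·𝔪_j(v̄;z) dz`**, written with the literal triples
`(b_j; b_{j′}+b_{j″}, b_{j′}b_{j″}) = (1; 2+3, 2·3), (2; 3+1, 3·1), (3; 1+2, 1·2)` and Prop 7.1's weights
`c = (½, 2, 3/2)`; `𝔪_j` is applied to the conjugate profile `v̄` (derivative `conj v′`).
[cite: Zhang2022LandauSiegel, Prop 7.1 with (8.11)–(8.23), pp.44–50] -/
def k0X (u u' v v' : ℝ → ℂ) : ℂ :=
  1 / 2 * (∫ z in (0:ℝ)..1,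
      k0jet 1 u u' z * k0mass (2 + 3) (2 * 3) (fun t => conj (v t)) (fun t => conj (v' t)) z)
    + 2 * (∫ z in (0:ℝ)..1,
      k0jet 2 u u' z * k0mass (3 + 1) (3 * 1) (fun t => conj (v t)) (fun t => conj (v' t)) z)
    + 3 / 2 * (∫ z in (0:ℝ)..1,
      k0jet 3 u u' z * k0mass (1 + 2) (1 * 2) (fun t => conj (v t)) (fun t => conj (v' t)) z)

/-- **DISPLAY #5's degree-0 polar table, LITERALLY**: `K0polar(u,v) := −(1/π)[X(u,v) + conj X(v,u)]`
(`⟨H_u,H_v⟩ = 𝔞𝔭·K0polar(u,v) + o(𝔞𝔭)` is the display's reading of Lemma 8.1 + formula I; that reading is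
NOT asserted here — only the closed form is defined). [cite: Zhang2022LandauSiegel, Prop 7.1 with (8.11)–(8.23), pp.44–50] -/
def k0polarDisplay (u u' v v' : ℝ → ℂ) : ℂ :=
  -(((1 / π : ℝ)) : ℂ) * (k0X u u' v v' + conj (k0X v v' u u'))

/-- **The dictionary, pointwise**: `𝔧_j(u;z)·𝔪(bS j, bN j; v̄)(z) = −dipoleIntegrand j u u′ v v′ z`
(`Repair.bS j = b_{j′}+b_{j″}`, `Repair.bN j = b_{j′}b_{j″}`; pure algebra, `∫_z^1 conj v = conj ∫_z^1 v`).
[cite: Zhang2022LandauSiegel, Prop 7.1 with (8.11)–(8.23), pp.44–50] -/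
theorem k0jet_mul_k0mass_eq (j : ℕ) (u u' v v' : ℝ → ℂ) (z : ℝ) :
    k0jet j u u' z * k0mass (Repair.bS j) (Repair.bN j) (fun t => conj (v t)) (fun t => conj (v' t)) z
      = -Repair.dipoleIntegrand j u u' v v' z := by
  unfold k0jet k0mass Repair.dipoleIntegrand
  rw [← conj_intervalIntegral_ke]
  simp only [map_add, map_mul, map_pow, Complex.conj_I, Complex.conj_ofReal]
  ring

/-- **The dictionary**: `X(u,v) = −π·Mform(u,v)` (`(2+3, 2·3) = (bS 1, bN 1)`, `(3+1, 3·1) = (bS 2, bN 2)`,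
`(1+2, 1·2) = (bS 3, bN 3)`; no hypothesis on the profiles). [cite: Zhang2022LandauSiegel, Prop 7.1 with (8.11)–(8.23), pp.44–50] -/
theorem k0X_eq_neg_pi_mul_Mform (u u' v v' : ℝ → ℂ) :
    k0X u u' v v' = -(π : ℂ) * Repair.Mform u u' v v' := by
  have h1 : ((2 : ℝ) + 3) = Repair.bS 1 := by rw [Repair.bS_one]; norm_num
  have h1' : ((2 : ℝ) * 3) = Repair.bN 1 := by rw [Repair.bN_one]; norm_num
  have h2 : ((3 : ℝ) + 1) = Repair.bS 2 := by rw [Repair.bS_two]; norm_num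
  have h2' : ((3 : ℝ) * 1) = Repair.bN 2 := by rw [Repair.bN_two]; norm_num
  have h3 : ((1 : ℝ) + 2) = Repair.bS 3 := by rw [Repair.bS_three]; norm_num
  have h3' : ((1 : ℝ) * 2) = Repair.bN 3 := by rw [Repair.bN_three]; norm_num
  have hπ : (π : ℂ) ≠ 0 := by exact_mod_cast Real.pi_ne_zero
  unfold k0X Repair.Mform
  rw [h1, h1', h2, h2', h3, h3']
  simp only [k0jet_mul_k0mass_eq, intervalIntegral.integral_neg]
  push_cast
  field_simp
  ring

/-- **K1″a DISPLAY #5's degree-0 polar table `K0polar(u,v)`** in tree vocabulary: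
`K0polar(u,v) := −(1/π) Σ_j c_j [∫₀¹ 𝔧_j(u;z)𝔪_j(v̄;z)dz + conj ∫₀¹ 𝔧_j(v;z)𝔪_j(ū;z)dz]`
with `𝔧_j(u;z) = u′(z) + iπb_ju(z)` (LEMMA A), `𝔪_j(w;z) = −π²b_{j′}b_{j″}∫_z^1w + iπ(b_{j′}+b_{j″})w(z) − w′(z)`
(LEMMA A*), `b = (1,2,3)`, `c = (½,2,3/2)` — which is, definitionally, formula I symmetrised:
`Mform u u′ v v′ + conj (Mform v v′ u u′)` (`Σ_jc_j∫𝔧_j(u)𝔪_j(v̄) = −π·Mform(u,v)`, dictionary in the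
module docstring). [cite: Zhang2022LandauSiegel, Prop 7.1 with (8.11)–(8.23), pp.44–50] -/
def k0polar (u u' v v' : ℝ → ℂ) : ℂ :=
  Repair.Mform u u' v v' + conj (Repair.Mform v v' u u')

/-- **DISPLAY #5's literal closed form IS formula I symmetrised**: `k0polarDisplay = k0polar`
(unconditional; `conj π = π`). [cite: Zhang2022LandauSiegel, Prop 7.1 with (8.11)–(8.23), pp.44–50] -/
theorem k0polarDisplay_eq_k0polar (u u' v v' : ℝ → ℂ) :
    k0polarDisplay u u' v v' = k0polar u u' v v' := by
  have hπ : (π : ℂ) ≠ 0 := by exact_mod_cast Real.pi_ne_zero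
  unfold k0polarDisplay k0polar
  rw [k0X_eq_neg_pi_mul_Mform, k0X_eq_neg_pi_mul_Mform]
  simp only [map_mul, map_neg, Complex.conj_ofReal]
  push_cast
  field_simp
  ring

/-- **The defect form `Δ(u,v)`** of DISPLAY #5 / the critic's (P0):
`Δ(u,v) = −12π[conj(m_v)·u(1) + m_u·conj(v(1))] − 8i[u(0)·conj(v(1)) − u(1)·conj(v(0))]`, `m_w = ∫₀¹ w`.
[cite: Zhang2022LandauSiegel, Prop 7.1 with (8.11)–(8.23), pp.44–50] -/
def k0polarDefect (u v : ℝ → ℂ) : ℂ :=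
  -(((12 * π : ℝ)) : ℂ) * (conj (∫ x in (0:ℝ)..1, v x) * u 1 + (∫ x in (0:ℝ)..1, u x) * conj (v 1))
    - 8 * I * (u 0 * conj (v 1) - u 1 * conj (v 0))

/-- `K0polar` is Hermitian: `K0polar(v,u) = conj K0polar(u,v)`. [cite: Zhang2022LandauSiegel, Prop 7.1 with (8.11)–(8.23), pp.44–50] -/
theorem k0polar_swap (u u' v v' : ℝ → ℂ) :
    k0polar v v' u u' = conj (k0polar u u' v v') := by
  simp only [k0polar, map_add, Complex.conj_conj, add_comm]

/-- **`P − K0polar = Δ` for every pair of kinked profiles** (no endpoint condition):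
`mainTermFormPolar u u′ v v′ − K0polar(u,v) = Δ(u,v)`. [cite: Zhang2022LandauSiegel, Prop 7.1 with (8.11)–(8.23), pp.44–50] -/
theorem mainTermFormPolar_sub_k0polar (hu : Repair.KinkedProfile u u') (hv : Repair.KinkedProfile v v') :
    mainTermFormPolar u u' v v' - k0polar u u' v v' = k0polarDefect u v := by
  rw [k0polar, k0polarDefect]
  exact Repair.mainTermFormPolar_sub_Mform hu hv

/-- The defect vanishes on the one-sided class `u(1) = v(1) = 0`. [cite: Zhang2022LandauSiegel, Prop 7.1 with (8.11)–(8.23), pp.44–50] -/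
theorem k0polarDefect_eq_zero (hu1 : u 1 = 0) (hv1 : v 1 = 0) : k0polarDefect u v = 0 := by
  simp [k0polarDefect, hu1, hv1]

/-- **DISPLAY #5 §3 / M-RULEBOOK (D15) «(S)» in the kernel**: on in-class (one-sided) kinked pairs,
`K0polar(u,v) = mainTermFormPolar u u′ v v′` — one line from the tree's Gram identity
`Repair.mainTermFormPolar_eq_Mform` (p423709). [cite: Zhang2022LandauSiegel, Prop 7.1 with (8.11)–(8.23), pp.44–50] -/
theorem k0polar_eq_mainTermFormPolar (hu : Repair.KinkedProfile u u') (hv : Repair.KinkedProfile v v')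
    (hu1 : u 1 = 0) (hv1 : v 1 = 0) :
    k0polar u u' v v' = mainTermFormPolar u u' v v' :=
  (Repair.mainTermFormPolar_eq_Mform hu hv hu1 hv1).symm

/-- The same through the defect identity (consistency of the two routes). [cite: Zhang2022LandauSiegel, Prop 7.1 with (8.11)–(8.23), pp.44–50] -/
theorem k0polar_eq_mainTermFormPolar' (hu : Repair.KinkedProfile u u') (hv : Repair.KinkedProfile v v')
    (hu1 : u 1 = 0) (hv1 : v 1 = 0) :
    k0polar u u' v v' = mainTermFormPolar u u' v v' := by
  have h := mainTermFormPolar_sub_k0polar hu hv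
  rw [k0polarDefect_eq_zero hu1 hv1, sub_eq_zero] at h
  exact h.symm

/-- **On the diagonal, in class: `K0polar(u,u) = 𝔅(u)`** (`mainTermForm`, the closed form of
`KnifeEdge.InClassMean`). [cite: Zhang2022LandauSiegel, Prop 7.1 with (8.11)–(8.23), pp.44–50] -/
theorem k0polar_self_eq_mainTermForm (hu : Repair.KinkedProfile u u') (hu1 : u 1 = 0) :
    k0polar u u' u u' = (mainTermForm u u' : ℂ) := by
  rw [k0polar_eq_mainTermFormPolar hu hu hu1 hu1, mainTermFormPolar_self]

end KnifeEdge

end Literature.NumberTheory.LFunctions.Zhang2022
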